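import Summits.KontsevichZagierPeriods.KontsevichZagierPeriods.Theorems.RootDecompRationalCubeDichotomyNashMultiGenP15

/-! # `RootDecompRationalCubeDichotomyNashMultiGenP16` — part 16/16 of the mechanical ≤385-line split of `NashEtaleMultiGen.lean`
(split by the decomp-kz census seat for landing; mathematics unchanged; part 16 continues part 15). -/

open Set MvPolynomial Filter Topology
open Literature.NumberTheory.Transcendental (IsSemialgebraicFunOn)
open Literature.ModelTheory.ExponentialFields (IsSemialgebraic isSemialgebraic_setOf_eval_pos
  isSemialgebraic_setOf_eval_ne_zero)

namespace Summit.KontsevichZagierPeriods.RootDecompRationalCubeDichotomy.Rung29430.MultiGen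
open Summit.KontsevichZagierPeriods.KontsevichZagierPeriods.Theses.RootDecompRationalCubeDichotomy
  (NashEtaleCover NashEtaleLocal PiRationalisation)
open Summit.KontsevichZagierPeriods.RootDecompRationalCubeDichotomy.Rung29430.NashEtaleLocalGlue
  (local_of_simple nashEtaleCover_of_nashEtaleLocal nashEtaleLocal_zero)
open Summit.KontsevichZagierPeriods.RootDecompRationalCubeDichotomy.Rung29430.NashEtaleLocalOne
  (analyticOnNhd_aeval_snoc)
open Summit.KontsevichZagierPeriods.RootDecompRationalCubeDichotomy.RungEtale.Etale
  (piRationalisation_of_nashEtaleCover)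

noncomputable section

section OriginOneKit
open Literature.NumberTheory.Transcendental Literature.ModelTheory.ExponentialFields
open Literature.NumberTheory.Transcendental.SemialgebraicDerivative
open Function
variable {K : Type} [CommRing K] [Algebra K ℝ]

/-- **(K4₀) A relation over `K`, non-zero over `ℝ`**: a `K`-semialgebraic function of `n` variables
satisfies `P(x, f x) = 0` on its domain for some `P ∈ K[x, w]` whose image in `ℝ[x, w]` is non-zero
(the graph has empty interior; `IsSemialgebraic.subset_interior_union` is `k`-general). -/
theorem exists_relationK {n : ℕ} {S : Set (Fin n → ℝ)} {f : (Fin n → ℝ) → ℝ}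
    (hf : IsSemialgebraicFunOn K S f) :
    ∃ P : MvPolynomial (Fin (n + 1)) K, MvPolynomial.map (algebraMap K ℝ) P ≠ 0 ∧
      ∀ x ∈ S, MvPolynomial.aeval (Fin.snoc x (f x) : Fin (n + 1) → ℝ) P = 0 := by
  classical
  set G : Set (Fin (n + 1) → ℝ) := {z | ∃ x ∈ S, z = Fin.snoc x (f x)} with hG_def
  have hG : IsSemialgebraic K G := hf
  have hint : interior G = ∅ := by
    refine Set.eq_empty_iff_forall_notMem.mpr fun z hz => ?_
    obtain ⟨ε, hε, hball⟩ := Metric.mem_nhds_iff.mp (mem_interior_iff_mem_nhds.mp hz)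
    obtain ⟨x, -, hzx⟩ := interior_subset hz
    set z' : Fin (n + 1) → ℝ := Function.update z (Fin.last n) (z (Fin.last n) + ε / 2) with hz'
    have hz'ball : z' ∈ Metric.ball z ε := by
      rw [Metric.mem_ball, dist_pi_lt_iff hε]
      intro b
      by_cases hb : b = Fin.last n
      · subst hb
        rw [hz', Function.update_self, Real.dist_eq,
          show z (Fin.last n) + ε / 2 - z (Fin.last n) = ε / 2 by ring, abs_of_pos (by linarith)]
        linarith
      · rw [hz', Function.update_of_ne hb, dist_self]
        exact hε
    obtain ⟨x', -, hz'x⟩ := hball hz'ball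
    have h1 : Fin.init z' = Fin.init z := by
      rw [hz']
      exact Fin.init_update_last _ _
    have hx : Fin.init z = x := by rw [hzx, Fin.init_snoc]
    have hx' : Fin.init z' = x' := by rw [hz'x, Fin.init_snoc]
    have hxx' : x' = x := by rw [← hx', h1, hx]
    have hlast : z' (Fin.last n) = z (Fin.last n) := by
      rw [hz'x, hzx, Fin.snoc_last, Fin.snoc_last, hxx']
    rw [hz', Function.update_self] at hlast
    linarith
  obtain ⟨Q₀, hQ₀, hsub⟩ := hG.subset_interior_union
  rw [hint, Set.empty_union] at hsub
  refine ⟨∏ q ∈ Q₀, q, ?_, fun x hx => ?_⟩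
  · rw [map_prod]
    refine Finset.prod_ne_zero_iff.mpr fun q hq h0 => ?_
    obtain ⟨y, hy⟩ := hQ₀ q hq
    apply hy
    rw [MvPolynomial.aeval_def, ← MvPolynomial.eval_map, h0, map_zero]
  · have hz : (Fin.snoc x (f x) : Fin (n + 1) → ℝ) ∈ G := ⟨x, hx, rfl⟩
    obtain ⟨q, hq, hq0⟩ : ∃ q ∈ Q₀, MvPolynomial.aeval (Fin.snoc x (f x) : Fin (n + 1) → ℝ) q = 0 := by
      simpa only [Set.mem_iUnion, Set.mem_setOf_eq, exists_prop] using hsub hz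
    rw [map_prod]
    exact Finset.prod_eq_zero hq hq0

/-- A `K`-polynomial with non-zero image in `ℝ[x]` does not vanish at some real point. -/
theorem exists_aeval_ne_zero_of_map_ne_zero {N : ℕ} {P : MvPolynomial (Fin N) K}
    (hP : MvPolynomial.map (algebraMap K ℝ) P ≠ 0) : ∃ y : Fin N → ℝ, MvPolynomial.aeval y P ≠ 0 := by
  by_contra h
  push Not at h
  apply hP
  apply MvPolynomial.funext
  intro y
  rw [MvPolynomial.eval_map, ← MvPolynomial.aeval_def, h y, map_zero]

end OriginOneKit

end

end Summit.KontsevichZagierPeriods.RootDecompRationalCubeDichotomy.Rung29430.MultiGen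

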